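import Literature.Geometry.Kaehler.ComplexTorusDivisorTangentConeVertex
import HarnessLib

/-!
# The vertex of the tangent cone is the common kernel of the polar forms: `(f)_r(u + c·w) = (f)_r(u)`
# for all `u, c` iff `D^r f(v)(w, ·) = 0` (Ciliberto–van der Geer's `Vert(TC_ξ)`, both descriptions)

[tag: lange-cav-complex-tori] [linked: HodgeConjecture (lit-hodgefound SKELETON §A2, row A2-194)]

Layer `Literature/Geometry/Kaehler`, namespaces `Literature.Geometry.Kaehler.SCV` (§1–§2) and
`Literature.Geometry.Kaehler.ComplexTorus` (§3); lane `lit-hodgefound` (Track 2 foundations library),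
skeleton seat `lit-hodgefound-skel-2` (generation 41), plan row A2-194: the converse of A2-191
`ComplexTorusDivisorTangentConeVertex` (`apply_const_add_eq_of_apply_cons_eq_zero`: polar forms vanish ⇒
translation invariance), using the polarization lemma of A2-174 (rider A2-174-r1,
`ContinuousMultilinearMap.eq_zero_of_forall_perm_of_forall_diag`). Theorems only; no definition, no named
fact.

Sources, VERBATIM. C. Ciliberto, G. van der Geer, *Andreotti–Mayer loci and the Schottky problem*, Doc.
Math. 13 (2008) [held `paper:arxiv-math_0701353`, chunk p0007]: "We will denote by `Vert(TC_ξ)` the vertex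
of `TC_ξ`, i.e., the subspace of `ℙ^{g−1}` which is the locus of points of multiplicity `r` of `TC_ξ`.
[…] In case `r = 2`, the tangent cone `TC_ξ` is the quadric `Q_ξ` […] and `Vert(TC_ξ)` is its vertex
`Π_ξ`."; ibid.: "Consider then the quadric `Q_ξ^J` […] This is a polar quadric of `TC_ξ`, namely it is
obtained from `TC_ξ` by iterated operations of polarization."; Prop. 8 (i) (chunk p0004): "`Π_ξ` is the
vertex of the quadric `Q_ξ`" with `Π_ξ` the kernel of the Hessian matrix. E. M. Chirka, *Complex Analytic
Sets* (1989), A1.1 (the homogeneous polynomial `(f)_m` and its coefficients), §1.5 (p. 10), §8.4 Prop. 1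
(p. 84: the tangent cone is the zero cone of `(f)_μ`).

Dictionary. For a symmetric `r`-linear form `M` (`r = k + 1`) with diagonal `P(u) = M(u, …, u)` a vector
`w` is a VERTEX DIRECTION iff `P(u + c·w) = P(u)` for all `u, c` ("points of multiplicity `r` of the
hypersurface `P = 0`", projectively); the POLAR FORMS of `P` with respect to `w` are `M(w, u_2, …, u_r)`.
This file proves the two descriptions agree: `w` is a vertex direction iff all its polar forms vanish, i.e.
iff `w` lies in the common kernel of the symmetric tensor `M` — for `r = 2` the kernel of the Hessian
(A2-188).

## Contents

* §1 symmetric multilinear forms: `hasDerivAt_apply_const_add_smul` (`d/dt M(u + tw, …) |₀ =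
  (k+1) · M(w, u, …, u)`), `apply_cons_const_eq_zero_of_forall_apply_const_add_smul_eq`,
  `curryLeft_comp_perm` (the polar form `M(w, ·)` is symmetric),
  **`apply_cons_eq_zero_of_forall_apply_const_add_smul_eq`** (vertex direction ⇒ all polar forms vanish —
  polarization), **`forall_apply_cons_eq_zero_iff`** (THE EQUIVALENCE).
* §2 entire `f` with `ord_v f = k + 1`: **`forall_leadingForm_add_smul_eq_iff`** (`w ∈ Vert(TC_v)` iff
  `D^{k+1} f(v)(w, ·) = 0`), `forall_leadingForm_add_smul_eq_iff_fderiv_fderiv_eq_zero` (`k = 1`: iff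
  `w ∈ Ker D²f(v)`, A2-188), `leadingForm_add_eq_of_vertex_add` (vertex directions form a subspace).
* §3 complex tori, `D = (ϑ)`, `mult_x(D) = k + 1`: **`forall_leadingForm_add_smul_eq_iff_thetaFunction`**,
  `forall_leadingForm_add_smul_eq_iff_mem_ker` (double points: vertex of `TC_x(D)` = `Ker D²ϑ(v)`).

## References

* [CilibertoVandergeer2008] C. Ciliberto, G. van der Geer, Doc. Math. 13 (2008), §(tangent cones of higher
  multiplicity) chunk p0007 (`Vert(TC_ξ)`, polar quadrics), Prop. 8 (i) (chunk p0004).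
* [Chirka1989] E. M. Chirka, *Complex Analytic Sets* (1989), A1.1, §1.5 (p. 10), §8.4 Prop. 1 (p. 84).
* [Lange2023AbelianVarietiesComplex] H. Lange (2023), §2.3.4 (p. 105 L20).
-/

noncomputable section

open scoped Manifold Topology
open Set Function Module Filter

namespace Literature.Geometry.Kaehler

universe u

namespace SCV

variable {E : Type*} [NormedAddCommGroup E] [NormedSpace ℂ E]

/-! ### §1 Symmetric multilinear forms: vertex directions ⟺ vanishing polar forms -/

omit [NormedAddCommGroup E] [NormedSpace ℂ E] in
/-- `update (u, …, u) 0 w = (w, u, …, u)`. [folklore] [cite: Chirka1989, A1.1] -/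
private theorem update_const_zero_eq_cons {k : ℕ} (u w : E) :
    update (fun _ : Fin (k + 1) => u) 0 w = (Fin.cons w (fun _ : Fin k => u) : Fin (k + 1) → E) := by
  funext i
  refine Fin.cases ?_ (fun j => ?_) i
  · simp
  · simp [Fin.succ_ne_zero]

/-- By symmetry every `M(u, …, w@j, …, u)` equals `M(w, u, …, u)`. [cite: Chirka1989, A1.1] -/
private theorem apply_update_const_eq {k : ℕ} (M : E [×(k + 1)]→L[ℂ] ℂ)
    (hM : ∀ (x : Fin (k + 1) → E) (σ : Equiv.Perm (Fin (k + 1))), M (x ∘ σ) = M x) (u w : E)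
    (j : Fin (k + 1)) : M (update (fun _ => u) j w) = M (Fin.cons w (fun _ : Fin k => u)) := by
  classical
  have hx : update (fun _ : Fin (k + 1) => u) j w =
      update (fun _ : Fin (k + 1) => u) 0 w ∘ Equiv.swap 0 j := by
    funext i
    simp only [comp_apply, update_apply]
    by_cases hij : i = j
    · subst hij
      simp
    · rw [if_neg hij, if_neg]
      intro h0
      rw [Equiv.swap_apply_eq_iff, Equiv.swap_apply_left] at h0
      exact hij h0
  rw [hx, hM, update_const_zero_eq_cons]

/-- **`d/dt|₀ M(u + tw, …, u + tw) = (k + 1) · M(w, u, …, u)`** for a symmetric `(k+1)`-form (Euler /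
first polar). [cite: CilibertoVandergeer2008, §(tangent cones), chunk p0007 ("obtained from `TC_ξ` by iterated operations of polarization")] [cite: Chirka1989, A1.1] -/
theorem hasDerivAt_apply_const_add_smul {k : ℕ} (M : E [×(k + 1)]→L[ℂ] ℂ)
    (hM : ∀ (x : Fin (k + 1) → E) (σ : Equiv.Perm (Fin (k + 1))), M (x ∘ σ) = M x) (u w : E) :
    HasDerivAt (fun t : ℂ => M (fun _ => u + t • w))
      (((k + 1 : ℕ) : ℂ) * M (Fin.cons w (fun _ : Fin k => u))) 0 := by
  classical
  let Δ : E →L[ℂ] (Fin (k + 1) → E) := ContinuousLinearMap.pi fun _ => ContinuousLinearMap.id ℂ E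
  have hΔapp : ∀ x : E, (Δ x : Fin (k + 1) → E) = fun _ => x := fun x => rfl
  -- derivative of the diagonal map `x ↦ M(x, …, x)` at `u`
  have hP : HasFDerivAt (fun x : E => M (fun _ => x)) ((M.linearDeriv (Δ u)).comp Δ) u := by
    have h := (M.hasFDerivAt (Δ u)).comp u Δ.hasFDerivAt
    simp only [Function.comp_def, hΔapp] at h
    exact h
  -- along the line `t ↦ u + t w`
  have hz : HasDerivAt (fun t : ℂ => u + t • w) w 0 := by
    simpa using ((hasDerivAt_id (0 : ℂ)).smul_const w).const_add u
  have hcomp : HasDerivAt (fun t : ℂ => M (fun _ => u + t • w)) ((M.linearDeriv (Δ u)).comp Δ w) 0 := by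
    have hu : u + (0 : ℂ) • w = u := by simp
    have hP' : HasFDerivAt (fun x : E => M (fun _ => x)) ((M.linearDeriv (Δ u)).comp Δ) (u + (0 : ℂ) • w) := by
      rw [hu]
      exact hP
    have hc : HasDerivAt ((fun x : E => M (fun _ => x)) ∘ (fun t : ℂ => u + t • w))
        ((M.linearDeriv (Δ u)).comp Δ w) 0 := hP'.comp_hasDerivAt 0 hz
    exact hc
  have hL : (M.linearDeriv (Δ u)).comp Δ w = ((k + 1 : ℕ) : ℂ) * M (Fin.cons w fun _ : Fin k => u) := by
    rw [ContinuousLinearMap.comp_apply, ContinuousMultilinearMap.linearDeriv_apply, hΔapp u]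
    have hΔw : ∀ i : Fin (k + 1), (Δ w : Fin (k + 1) → E) i = w := fun i => rfl
    simp only [hΔw]
    rw [Finset.sum_congr rfl fun i _ => apply_update_const_eq M hM u w i, Finset.sum_const,
      Finset.card_univ, Fintype.card_fin, nsmul_eq_mul]
  rw [← hL]
  exact hcomp

/-- If `w` is a vertex direction of `u ↦ M(u, …, u)` — `M(u + tw, …, u + tw) = M(u, …, u)` for all `u, t` —
then the FIRST polars vanish on the diagonal: `M(w, u, …, u) = 0`. [cite: CilibertoVandergeer2008, §(tangent cones), chunk p0007] [cite: Chirka1989, A1.1] -/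
theorem apply_cons_const_eq_zero_of_forall_apply_const_add_smul_eq {k : ℕ} (M : E [×(k + 1)]→L[ℂ] ℂ)
    (hM : ∀ (x : Fin (k + 1) → E) (σ : Equiv.Perm (Fin (k + 1))), M (x ∘ σ) = M x) {w : E}
    (hw : ∀ (u : E) (t : ℂ), M (fun _ => u + t • w) = M (fun _ => u)) (u : E) :
    M (Fin.cons w (fun _ : Fin k => u)) = 0 := by
  have h1 := hasDerivAt_apply_const_add_smul M hM u w
  have h0 : HasDerivAt (fun t : ℂ => M (fun _ => u + t • w)) 0 0 := by
    have hconst : (fun t : ℂ => M (fun _ => u + t • w)) = fun _ => M (fun _ => u) := funext fun t => hw u t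
    rw [hconst]
    exact hasDerivAt_const 0 _
  have h := h1.unique h0
  rw [mul_eq_zero] at h
  exact h.resolve_left (Nat.cast_ne_zero.2 (Nat.succ_ne_zero k))

/-- **The polar form `M(w, ·)` (`curryLeft`) of a symmetric form is symmetric.** [cite: Chirka1989, A1.1] -/
theorem curryLeft_comp_perm {k : ℕ} (M : E [×(k + 1)]→L[ℂ] ℂ)
    (hM : ∀ (x : Fin (k + 1) → E) (σ : Equiv.Perm (Fin (k + 1))), M (x ∘ σ) = M x) (w : E)
    (x : Fin k → E) (σ : Equiv.Perm (Fin k)) : M.curryLeft w (x ∘ σ) = M.curryLeft w x := by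
  rw [ContinuousMultilinearMap.curryLeft_apply, ContinuousMultilinearMap.curryLeft_apply]
  let τ : Equiv.Perm (Fin (k + 1)) := (finSuccEquiv k).trans ((Equiv.optionCongr σ).trans (finSuccEquiv k).symm)
  have hx : (Fin.cons w (x ∘ σ) : Fin (k + 1) → E) = (Fin.cons w x : Fin (k + 1) → E) ∘ τ := by
    funext i
    refine Fin.cases ?_ (fun j => ?_) i
    · simp [τ]
    · simp [τ]
  rw [hx, hM]

/-- **VERTEX DIRECTION ⇒ ALL POLAR FORMS VANISH**: if `M(u + tw, …) = M(u, …)` for all `u, t` then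
`M(w, u_1, …, u_k) = 0` for all `u_i` (the symmetric `k`-form `M(w, ·)` has zero diagonal, hence vanishes
by polarization, A2-174-r1). [cite: CilibertoVandergeer2008, §(tangent cones), chunk p0007 ("`Vert(TC_ξ)` […] the locus of points of multiplicity `r` of `TC_ξ`") and Prop. 8 (i) (chunk p0004)] [cite: Chirka1989, A1.1] -/
theorem apply_cons_eq_zero_of_forall_apply_const_add_smul_eq {k : ℕ} (M : E [×(k + 1)]→L[ℂ] ℂ)
    (hM : ∀ (x : Fin (k + 1) → E) (σ : Equiv.Perm (Fin (k + 1))), M (x ∘ σ) = M x) {w : E}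
    (hw : ∀ (u : E) (t : ℂ), M (fun _ => u + t • w) = M (fun _ => u)) (u' : Fin k → E) :
    M (Fin.cons w u') = 0 := by
  have hN : M.curryLeft w = 0 :=
    ContinuousMultilinearMap.eq_zero_of_forall_perm_of_forall_diag (M.curryLeft w) (curryLeft_comp_perm M hM w)
      fun u => by
        rw [ContinuousMultilinearMap.curryLeft_apply]
        exact apply_cons_const_eq_zero_of_forall_apply_const_add_smul_eq M hM hw u
  have h := congrArg (fun N : E [×k]→L[ℂ] ℂ => N u') hN
  simp only [ContinuousMultilinearMap.curryLeft_apply, _root_.zero_apply] at h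
  exact h

/-- **THE TWO DESCRIPTIONS OF THE VERTEX AGREE**: for a symmetric `(k+1)`-form `M` and a vector `w`,
ALL POLAR FORMS `M(w, ·)` VANISH iff `u ↦ M(u, …, u)` IS INVARIANT UNDER TRANSLATION BY `ℂw`.
[cite: CilibertoVandergeer2008, §(tangent cones), chunk p0007 and Prop. 8 (i) (chunk p0004: "`Π_ξ` is the vertex of the quadric `Q_ξ`")] [cite: Chirka1989, A1.1 and §8.4 Prop. 1 (p. 84)] -/
theorem forall_apply_cons_eq_zero_iff {k : ℕ} (M : E [×(k + 1)]→L[ℂ] ℂ)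
    (hM : ∀ (x : Fin (k + 1) → E) (σ : Equiv.Perm (Fin (k + 1))), M (x ∘ σ) = M x) (w : E) :
    (∀ u' : Fin k → E, M (Fin.cons w u') = 0) ↔ ∀ (u : E) (t : ℂ), M (fun _ => u + t • w) = M (fun _ => u) := by
  refine ⟨fun hw u t => ?_, fun hw => apply_cons_eq_zero_of_forall_apply_const_add_smul_eq M hM hw⟩
  refine apply_const_add_eq_of_apply_cons_eq_zero M hM (fun u' => ?_) u
  have hupd : (Fin.cons (t • w) u' : Fin (k + 1) → E) = Function.update (Fin.cons w u' : Fin (k + 1) → E) 0 (t • w) := by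
    rw [Fin.update_cons_zero]
  rw [hupd, ContinuousMultilinearMap.map_update_smul, Fin.update_cons_zero, hw u', smul_zero]

/-! ### §2 Entire functions: `Vert(TC_v) = ⋂ Ker` of the polar forms of `(f)_r` -/

/-- **`w` IS A VERTEX DIRECTION OF THE TANGENT CONE AT A POINT OF ORDER `k + 1` IFF ALL POLAR FORMS
`D^{k+1} f(v)(w, ·)` VANISH.** [cite: CilibertoVandergeer2008, §(tangent cones), chunk p0007 ("`Vert(TC_ξ)`"; "polar quadric of `TC_ξ` […] obtained from `TC_ξ` by iterated operations of polarization")] [cite: Chirka1989, §8.4 Prop. 1 (p. 84) and A1.1] -/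
theorem forall_leadingForm_add_smul_eq_iff {f : E → ℂ} (hf : Differentiable ℂ f) {v : E} {k : ℕ}
    (hk : pointOrder f v = ((k + 1 : ℕ) : ℕ∞)) (w : E) :
    (∀ (u : E) (c : ℂ), leadingForm f v (u + c • w) = leadingForm f v u) ↔
      ∀ u' : Fin k → E, iteratedFDeriv ℂ (k + 1) f v (Fin.cons w u') = 0 := by
  rw [forall_apply_cons_eq_zero_iff _ (iteratedFDeriv_comp_perm_of_differentiable hf v) w]
  simp only [leadingForm_of_pointOrder_eq hk]

/-- `k = 1` (double points): **`w` is a vertex direction of the tangent cone quadric iff `w ∈ Ker D²f(v)`**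
— the vertex `Π` of A2-188. [cite: CilibertoVandergeer2008, Prop. 8 (i) (chunk p0004: "`Π_ξ` is the vertex of the quadric `Q_ξ`")] -/
theorem forall_leadingForm_add_smul_eq_iff_fderiv_fderiv_eq_zero {f : E → ℂ} (hf : Differentiable ℂ f)
    {v : E} (h2 : pointOrder f v = 2) (w : E) :
    (∀ (u : E) (c : ℂ), leadingForm f v (u + c • w) = leadingForm f v u) ↔ fderiv ℂ (fderiv ℂ f) v w = 0 := by
  rw [forall_leadingForm_add_smul_eq_iff hf (k := 1) (by exact_mod_cast h2) w]
  constructor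
  · intro h
    ext u
    have := h (fun _ => u)
    rw [iteratedFDeriv_two_apply, Fin.cons_zero] at this
    simpa using this
  · intro h u'
    rw [iteratedFDeriv_two_apply, Fin.cons_zero, h, _root_.zero_apply]

/-- **The vertex directions form a linear subspace**: sums of vertex directions are vertex directions
(via the kernel description). [cite: CilibertoVandergeer2008, §(tangent cones), chunk p0007 ("the subspace of `ℙ^{g−1}`")] -/
theorem leadingForm_add_eq_of_vertex_add {f : E → ℂ} (hf : Differentiable ℂ f) {v : E} {k : ℕ}
    (hk : pointOrder f v = ((k + 1 : ℕ) : ℕ∞)) {w₁ w₂ : E}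
    (h₁ : ∀ (u : E) (c : ℂ), leadingForm f v (u + c • w₁) = leadingForm f v u)
    (h₂ : ∀ (u : E) (c : ℂ), leadingForm f v (u + c • w₂) = leadingForm f v u) (u : E) (c : ℂ) :
    leadingForm f v (u + c • (w₁ + w₂)) = leadingForm f v u := by
  rw [forall_leadingForm_add_smul_eq_iff hf hk] at h₁ h₂
  refine (forall_leadingForm_add_smul_eq_iff hf hk (w₁ + w₂)).2 (fun u' => ?_) u c
  have hupd : (Fin.cons (w₁ + w₂) u' : Fin (k + 1) → E) =
      Function.update (Fin.cons w₁ u' : Fin (k + 1) → E) 0 (w₁ + w₂) := by rw [Fin.update_cons_zero]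
  rw [hupd, ContinuousMultilinearMap.map_update_add, Fin.update_cons_zero, Fin.update_cons_zero, h₁ u', h₂ u',
    add_zero]

end SCV

/-! ### §3 Complex tori: the vertex of `TC_x(D)` -/

namespace ComplexTorus

section Divisor

variable {ι : Type*} [Fintype ι] {E : Type u} [NormedAddCommGroup E] [InnerProductSpace ℂ E]
  [FiniteDimensional ℂ E] {Φ : (ι → ℝ) ≃L[ℝ] E} {d : ℕ} {n : ℕ} (e : Fin n ≃ ι) (h : 2 * d + 2 = n)
  {η : E [⋀^Fin 2]→L[ℝ] ℝ} {χ : (ι → ℤ) → ℂ}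

include e h in
/-- **For `D = (ϑ)` with `mult_x(D) = k + 1`, `x = π(v)`: a direction `w` is a vertex direction of the tangent
cone `TC_x(D) = {(ϑ)_{k+1} = 0}` (translation invariance of the leading form) iff all polar forms
`D^{k+1}ϑ(v)(w, ·)` vanish.** [cite: CilibertoVandergeer2008, §(tangent cones), chunk p0007 ("`Vert(TC_ξ)` […] the locus of points of multiplicity `r` of `TC_ξ`")] [cite: Lange2023AbelianVarietiesComplex, §2.3.4 (p. 105 L20)] -/
theorem forall_leadingForm_add_smul_eq_iff_thetaFunction (hη : IsNSForm Φ η) (hχ : IsSemicharacter Φ η χ)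
    {ϑ : E → ℂ} (hϑ : ϑ ∈ thetaFunctions Φ (canonicalFactor Φ η χ)) (hϑ0 : ϑ ≠ 0) {v : E} {k : ℕ}
    (hk : divisorMultAt Φ d (divisorChain Φ d ϑ) (cover Φ v) = ((k + 1 : ℕ) : ℕ∞)) (w : E) :
    (∀ (u : E) (c : ℂ), SCV.leadingForm ϑ v (u + c • w) = SCV.leadingForm ϑ v u) ↔
      ∀ u' : Fin k → E, iteratedFDeriv ℂ (k + 1) ϑ v (Fin.cons w u') = 0 := by
  rw [divisorMultAt_divisorChain_cover e h hη hχ hϑ hϑ0] at hk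
  exact SCV.forall_leadingForm_add_smul_eq_iff (mem_thetaFunctions_iff.1 hϑ).1 hk w

include e h in
/-- **Double points (`mult_x(D) = 2`): the vertex of the tangent cone quadric is `Ker D²ϑ(v)`** (the two
descriptions of `Π_ξ`, Prop. 8 (i), agree). [cite: CilibertoVandergeer2008, Prop. 8 (i) (chunk p0004: "`Π_ξ` is the vertex of the quadric `Q_ξ`")] [cite: Grushevsky2012SchottkyProblem, §5 Thm. 5.6 (p. 11)] -/
theorem forall_leadingForm_add_smul_eq_iff_mem_ker (hη : IsNSForm Φ η) (hχ : IsSemicharacter Φ η χ)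
    {ϑ : E → ℂ} (hϑ : ϑ ∈ thetaFunctions Φ (canonicalFactor Φ η χ)) (hϑ0 : ϑ ≠ 0) {v : E}
    (h2 : divisorMultAt Φ d (divisorChain Φ d ϑ) (cover Φ v) = 2) (w : E) :
    (∀ (u : E) (c : ℂ), SCV.leadingForm ϑ v (u + c • w) = SCV.leadingForm ϑ v u) ↔
      w ∈ LinearMap.ker ((fderiv ℂ (fderiv ℂ ϑ) v : E →L[ℂ] (E →L[ℂ] ℂ)) : E →ₗ[ℂ] (E →L[ℂ] ℂ)) := by
  rw [divisorMultAt_divisorChain_cover e h hη hχ hϑ hϑ0] at h2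
  rw [LinearMap.mem_ker, ContinuousLinearMap.coe_coe]
  exact SCV.forall_leadingForm_add_smul_eq_iff_fderiv_fderiv_eq_zero (mem_thetaFunctions_iff.1 hϑ).1 h2 w

end Divisor

end ComplexTorus

end Literature.Geometry.Kaehler
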